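import Summits.HodgeConjecture.Ring2.LowDimensionHodgeOfMarkmanCaseG
import Literature.AlgebraicGeometry.HodgeTheory.RibetTypeOnePowersHodgeClasses
import Literature.AlgebraicGeometry.HodgeTheory.QuaternionMinimalPowersHodgeClasses
import HarnessLib

/-!
# Row `4` modulo Markman, refined: the simple non-CM fourfolds of RIBET TYPE `(3,1)` and of MINIMAL QUATERNION TYPE leave the residual cell

Cell `pub-hodge-ring2` (HONEST FRAMING: research route conditional on HC_CM; not a corollary; Q11.4-sentence-2 already
refuted in dim ≥ 3), Literature lane (lit seat, generation 63, programme R36). Sequel of `Ring2/LowDimensionHodgeOfMarkmanCaseG`.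
Theorems only (no definition, no named fact, no `sorry`); hypotheses `hMark` (the tree's named fact
`Markman2025_weilClasses_algebraic_abelianFourfold`) and Tankeev–Ribet where stated — explicit, not discharged.

THE POINT. The row-`4` residual cell «simple fourfolds not of CM type» (`hcAtDim_four_iff_simple_nonCM_of_markman`, R35-C) is
Moonen–Zarhin 1995 in print. Two of its sub-rows are ALREADY theorems of the tree, unconditionally: (i) RIBET TYPE — `End⁰(A)`
two-dimensional with `φ ≫ φ = -d` acting on `H^{1,0}(A)` with multiplicities `(3,1)` (`B•(Aⁿ) = D•(Aⁿ)`, Ribet 1983 Thm. 3; the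
tree's `hodgeConjectureFor_of_ribetTypeOne`, no simplicity needed); (ii) MINIMAL QUATERNION TYPE — `End⁰(A)` a quaternion
algebra over a totally real field `K` with `dim A = 2[K:ℚ]` (for fourfolds: `K` real quadratic; Banaszak–Gajda–Krasoń Thm. 7.34,
the tree's `hodgeConjectureFor_self_of_isSimple_quaternion_of_dim_eq`). This file subtracts them:
* **`hcAtDim_four_iff_of_markman'`** — `HCAtDim 4 ↔ HC(simple non-CM fourfolds neither of Ribet type nor of minimal quaternion
  type)`, granted `hMark`;
* **`hcUpToDim_five_iff_rowFour_caseG13_of_markman_of_tankeevRibet`** — the R35-F axis statement with the refined row-`4` cell.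
NOT CLAIMED: the remaining sub-rows of Moonen–Zarhin 1995 (types I(1), I(2), I(4), non-minimal II/III, IV(1,1) of Weil type —
which needs `Hg = SU(2,2)` for the tree's `isDivisorWeilGenerated_of_hasHodgeGroupSU` —, IV(2,1), IV with `d = 2`); nothing
on `D² ≠ B²`; no cell decided.

## References
* [MoonenZarhin1995Duke] B. Moonen, Yu. Zarhin, *Hodge classes and Tate classes on simple abelian fourfolds*, Duke Math. J.
  77 (1995), Thm. 2.4 (the row-`4` cell in print). [cite: MoonenZarhin1995Duke, Thm. 2.4]
* [Ribet1983] K. A. Ribet, Amer. J. Math. 105 (1983), Thm. 3. [cite: Ribet1983, Thm. 3]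
* [BanaszakGajdaKrason2006] G. Banaszak, W. Gajda, P. Krasoń, J. Number Theory (2006), Thm. 7.34. [cite: BanaszakGajdaKrason2006, Thm. 7.34]
* [MoonenZarhin1999LowDim] B. Moonen, Yu. Zarhin, Math. Ann. 315 (1999), §2 (2.3), Thm. 0.1. [cite: MoonenZarhin1999LowDim, §2 (2.3) and Thm. 0.1]
* [Markman2025SurveySecant] E. Markman, arXiv:2509.23403, Thm. 1.2. [claim: Markman2025SurveySecant, status: under-review]
* [Deligne2000] P. Deligne, *The Hodge conjecture* (Clay, 2000), §1. [cite: Deligne2000, §1]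
-/

noncomputable section

open CategoryTheory CategoryTheory.Limits

namespace Summit.HodgeConjecture.Ring2.LowDimOfMarkman

open Literature.AlgebraicGeometry.Motives (AbelianVariety)
open Literature.AlgebraicGeometry.Motives.AbelianVariety
open Literature.AlgebraicGeometry.HodgeTheory
open Literature.AlgebraicGeometry.ComplexMultiplication
open Literature.AlgebraicGeometry.Milne1999
open Summit.HodgeConjecture.CorCM.Domination
open NumberField
open Literature.NumberTheory.Automorphic (IsQuaternionAlgebra)
open Summit.HodgeConjecture.CorCM.CMWeights (hodgeConjectureFor_of_isOfCMType_dim_le_five_of_markman)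
open Summit.HodgeConjecture.HodgeConjecture.Ring2.ClassTargets

variable {X : AbelianVariety ℂ}

/-! ### §1 The two unconditional sub-rows, in row-`4` shape -/

/-- **A fourfold of Ribet type satisfies the Hodge conjecture** (the tree's `hodgeConjectureFor_of_ribetTypeOne`, `3 ≤ 4`).
[cite: Ribet1983, Thm. 3] [cite: MoonenZarhin1999LowDim, §2 (2.3)] -/
theorem hodgeConjectureFor_of_dim_eq_four_of_ribetTypeOne (hX4 : X.dim = 4) (φ : X ⟶ X) {d : ℕ} (hd : 0 < d)
    (hφ : φ ≫ φ = -(d • 𝟙 X)) (hE2 : Module.finrank ℚ X.endAlgebra = 2)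
    (h1 : eigenMultiplicity X φ (Complex.I * (Real.sqrt d : ℂ)) = 1 ∨
      eigenMultiplicity X φ (-(Complex.I * (Real.sqrt d : ℂ))) = 1) :
    HodgeConjectureFor X.dim X.X :=
  hodgeConjectureFor_of_ribetTypeOne X φ hd hφ hE2 h1 (by omega)

/-- **A simple abelian variety of minimal quaternion type satisfies the Hodge conjecture** (the tree's
`hodgeConjectureFor_self_of_isSimple_quaternion_of_dim_eq`, with the quaternion structure packaged as an existential over the
field `K` and its instances). [cite: BanaszakGajdaKrason2006, Thm. 7.34] -/
theorem hodgeConjectureFor_of_isSimple_of_exists_quaternion (hX : X.IsSimple)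
    (hQ : ∃ (K : Type) (_ : Field K) (_ : NumberField K) (_ : IsTotallyReal K) (_ : Algebra K X.endAlgebra)
      (_ : IsScalarTower ℚ K X.endAlgebra) (_ : IsQuaternionAlgebra K X.endAlgebra), X.dim = 2 * Module.finrank ℚ K) :
    HodgeConjectureFor X.dim X.X := by
  obtain ⟨K, _, _, _, _, _, _, hdim⟩ := hQ
  exact hodgeConjectureFor_self_of_isSimple_quaternion_of_dim_eq hX hdim

/-! ### §2 Row `4` refined -/

/-- **Row `4` modulo Markman, refined**: `HCAtDim 4 ↔ HC(simple fourfolds not of CM type, NOT of Ribet type `(3,1)`, NOT of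
minimal quaternion type)`. [cite: MoonenZarhin1995Duke, Thm. 2.4] [cite: Ribet1983, Thm. 3] [cite: BanaszakGajdaKrason2006, Thm. 7.34]
[claim: Markman2025SurveySecant, status: under-review] -/
theorem hcAtDim_four_iff_of_markman' (hMark : Markman2025_weilClasses_algebraic_abelianFourfold) :
    HCAtDim 4 ↔ HCOnClass fun A => A.dim = 4 ∧ A.IsSimple ∧ ¬ IsOfCMType A ∧
      (¬ ∃ (φ : A ⟶ A) (d : ℕ), 0 < d ∧ φ ≫ φ = -(d • 𝟙 A) ∧ Module.finrank ℚ A.endAlgebra = 2 ∧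
        (eigenMultiplicity A φ (Complex.I * (Real.sqrt d : ℂ)) = 1 ∨
          eigenMultiplicity A φ (-(Complex.I * (Real.sqrt d : ℂ))) = 1)) ∧
      (¬ ∃ (K : Type) (_ : Field K) (_ : NumberField K) (_ : IsTotallyReal K) (_ : Algebra K A.endAlgebra)
        (_ : IsScalarTower ℚ K A.endAlgebra) (_ : IsQuaternionAlgebra K A.endAlgebra), A.dim = 2 * Module.finrank ℚ K) := by
  rw [hcAtDim_four_iff_simple_nonCM_of_markman hMark]
  refine ⟨fun h => hcOnClass_mono (fun A hA => ⟨hA.1, hA.2.1, hA.2.2.1⟩) h, fun h A hA => ?_⟩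
  obtain ⟨hA4, hs, hcm⟩ := hA
  by_cases hR : ∃ (φ : A ⟶ A) (d : ℕ), 0 < d ∧ φ ≫ φ = -(d • 𝟙 A) ∧ Module.finrank ℚ A.endAlgebra = 2 ∧
      (eigenMultiplicity A φ (Complex.I * (Real.sqrt d : ℂ)) = 1 ∨
        eigenMultiplicity A φ (-(Complex.I * (Real.sqrt d : ℂ))) = 1)
  · obtain ⟨φ, d, hd, hφ, hE2, h1⟩ := hR
    exact hodgeConjectureFor_of_dim_eq_four_of_ribetTypeOne hA4 φ hd hφ hE2 h1
  by_cases hQ : ∃ (K : Type) (_ : Field K) (_ : NumberField K) (_ : IsTotallyReal K) (_ : Algebra K A.endAlgebra)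
      (_ : IsScalarTower ℚ K A.endAlgebra) (_ : IsQuaternionAlgebra K A.endAlgebra), A.dim = 2 * Module.finrank ℚ K
  · exact hodgeConjectureFor_of_isSimple_of_exists_quaternion hs hQ
  exact h A ⟨hA4, hs, hcm, hR, hQ⟩

/-- **The axis statement of gen 63, final form.** Granted the tree's named facts `Markman2025_weilClasses_algebraic_abelianFourfold`
and `TankeevRibet1983_hodgeClasses_divisorial_powers_simplePrimeDimension` (hypotheses): `HCUpToDim 5` is EQUIVALENT to the
Hodge conjecture on (α′) the simple non-CM fourfolds neither of Ribet type `(3,1)` nor of minimal quaternion type [the rest of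
Moonen–Zarhin 1995], (β) case (g) verbatim [Thm. 0.2 (3)] and (γ) case (e) ∩ (a1) [Thm. 0.2 (1)].
[cite: MoonenZarhin1999LowDim, Thm. 0.1, Thm. 0.2 (1), (3)] [cite: MoonenZarhin1995Duke, Thm. 2.4] [claim: Markman2025SurveySecant, status: under-review] -/
theorem hcUpToDim_five_iff_rowFour_caseG13_of_markman_of_tankeevRibet
    (hMark : Markman2025_weilClasses_algebraic_abelianFourfold)
    (hTR : TankeevRibet1983_hodgeClasses_divisorial_powers_simplePrimeDimension) :
    HCUpToDim 5 ↔ (HCOnClass fun A => A.dim = 4 ∧ A.IsSimple ∧ ¬ IsOfCMType A ∧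
      (¬ ∃ (φ : A ⟶ A) (d : ℕ), 0 < d ∧ φ ≫ φ = -(d • 𝟙 A) ∧ Module.finrank ℚ A.endAlgebra = 2 ∧
        (eigenMultiplicity A φ (Complex.I * (Real.sqrt d : ℂ)) = 1 ∨
          eigenMultiplicity A φ (-(Complex.I * (Real.sqrt d : ℂ))) = 1)) ∧
      (¬ ∃ (K : Type) (_ : Field K) (_ : NumberField K) (_ : IsTotallyReal K) (_ : Algebra K A.endAlgebra)
        (_ : IsScalarTower ℚ K A.endAlgebra) (_ : IsQuaternionAlgebra K A.endAlgebra), A.dim = 2 * Module.finrank ℚ K)) ∧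
      HCOnClass fun A => A.dim = 5 ∧
        ((∃ (C F : AbelianVariety ℂ) (χ : C ⟶ C) (d' : ℕ) (φ : F ⟶ F) (M : ℕ), C.dim = 1 ∧ 0 < d' ∧
          χ ≫ χ = -(d' • 𝟙 C) ∧ F.IsSimple ∧ F.dim = 4 ∧ ¬ IsOfCMType F ∧ 0 < M ∧ φ ≫ φ = -((M * M * d') • 𝟙 F) ∧
          AbelianVariety.endAlgebra.of F φ ∈ Subalgebra.center ℚ F.endAlgebra ∧
          (eigenMultiplicity F φ (Complex.I * (Real.sqrt (M * M * d' : ℕ) : ℂ)) = 1 ∨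
            eigenMultiplicity F φ (-(Complex.I * (Real.sqrt (M * M * d' : ℕ) : ℂ))) = 1) ∧
          AbelianVariety.IsIsogenous A (C.prod F)) ∨
        (∃ E T : AbelianVariety ℂ, E.dim = 1 ∧ IsOfCMType E ∧ T.IsSimple ∧ T.dim = 3 ∧
          Module.finrank ℚ T.endAlgebra = 2 ∧ Nonempty (E.endAlgebra →+* T.endAlgebra) ∧
          AbelianVariety.IsIsogenous A (E.prod (E.prod T)))) := by
  rw [hcUpToDim_five_iff_caseG13_of_markman_of_tankeevRibet hMark hTR, ← hcAtDim_four_iff_of_markman' hMark,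
    hcAtDim_four_iff_simple_nonCM_of_markman hMark]

/-- **On path**: every cell of this file is a case of the summit. [cite: Deligne2000, §1] -/
theorem rowFourResidualCell_of_hodgeConjecture (h : _root_.HodgeConjecture) :
    HCOnClass fun A => A.dim = 4 ∧ A.IsSimple ∧ ¬ IsOfCMType A ∧
      (¬ ∃ (φ : A ⟶ A) (d : ℕ), 0 < d ∧ φ ≫ φ = -(d • 𝟙 A) ∧ Module.finrank ℚ A.endAlgebra = 2 ∧
        (eigenMultiplicity A φ (Complex.I * (Real.sqrt d : ℂ)) = 1 ∨
          eigenMultiplicity A φ (-(Complex.I * (Real.sqrt d : ℂ))) = 1)) ∧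
      (¬ ∃ (K : Type) (_ : Field K) (_ : NumberField K) (_ : IsTotallyReal K) (_ : Algebra K A.endAlgebra)
        (_ : IsScalarTower ℚ K A.endAlgebra) (_ : IsQuaternionAlgebra K A.endAlgebra), A.dim = 2 * Module.finrank ℚ K) :=
  hcOnClass_of_hodgeConjecture _ h

end Summit.HodgeConjecture.Ring2.LowDimOfMarkman

end
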